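import Summits.HodgeConjecture.CorCM.Census.CentralSquaresRelations
import Summits.HodgeConjecture.CorCM.Census.CentralSquaresNearLattice

/-!
# The square-central class, VII: swapped transversals and the companion frame `(T₀; T̄₁, c·Q)`

COR-CM (cell `pub-hodgecm2`), count-neutral kernel combinatorics by the binder seat b09 (gen 45; lane SQUARE-CENTRAL CLASS, part VII), on parts II, V, VI
(`Census/CentralSquaresNearLattice.lean`, `…Exchange.lean`, `…Relations.lean`), BY NAME.  Theorems only: no definition, no `decide`, no certificate, no named
fact, no `sorry`.  HONEST FRAMING: `HC_CM` is NOT proved, here or anywhere in the tree; nothing here is a period or a headline.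

THE FRAME `(T₀; T₁, Q)` of parts IV–VI (base block `{T₀, T̄₀, T₁, T̄₁}`, `|T₀| = 4m`, `𝓗 = T₀ ∖ T₁` of size `2m`, swap `Q` with `T₀·Q⁻¹ = T₁`, `Q² = 1`,
place permutation `σ` preserving `𝓗`, base-change stable `L` with a strict lowering cover).  Notation `e₀, e₁, f_s, g_s`, `Y_s = (f_s − e₀) + (g_s − e₁)`,
`Y'_s = (f_s − e₀) − (g_s − e₁)`, `R(T)`, `Rᶜ(T')` as in part II.

* §1 `pair_stable`: a swapped pair `{s, σ s}` is stable under the place permutation; `rep_unique'`.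
* §2 **SWAPPED TRANSVERSALS** (`transversal_swap`): if `T ⊆ 𝓗` is a transversal containing `s`, so is `T.erase s ∪ {σ s}`; and
  (`rel_sub_rel_swap`) `R(T) − R(T.erase s ∪ {σ s}) = (f_s + g_s) − (f_{σs} + g_{σs})` — whence (`Y_sub_Y_mem`) `Y_s − Y_{σs} ∈ L` for every `s ∈ 𝓗`
  lying in some transversal.
* §3 **THE COMPANION FRAME** `(T₀; T̄₁, c·Q)`: same base block, same place permutation, `T₀·(cQ)⁻¹ = T̄₁`, `(cQ)² = 1`, `T₀ ∖ T̄₁ = T₀ ∩ T₁` of size `2m`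
  (`companion_*`); part VI applied there gives, modulo pairs (`relc_mem`, `Y_add_Y_mem`): `Rᶜ(T') ∈ L` for every transversal `T' ⊆ T₀ ∩ T₁`, and
  `Y_s + Y_{σs} ∈ L` for `s ∈ 𝓗`; symmetrically part VI in the original frame gives `Y'_a + Y'_{σa} ∈ L` (`a ∈ T₀ ∩ T₁`) and §2 in the companion frame
  `Y'_a − Y'_{σa} ∈ L`.  Part VIII adds them up (`2Y_s`, `2Y'_a ∈ L`) and closes the four-type law.

## References
* [Pohlmann1968] H. Pohlmann, Algebraic cycles on abelian varieties of complex multiplication type, Ann. of Math. 88 (1968), Thm 1.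
-/

namespace Summit.HodgeConjecture.CorCM.Census.CentralSquares

open Finset
open scoped symmDiff
open Summit.HodgeConjecture.CorCM.Prior.AllgGroup.RfwfAllgGroup
open Summit.HodgeConjecture.CorCM.Census.BlockParity
open Summit.HodgeConjecture.CorCM.Census.Coinvariant
open Summit.HodgeConjecture.CorCM.Census.TwistGeneration
open Summit.HodgeConjecture.CorCM.Census.BaseBlock
open Summit.HodgeConjecture.CorCM.Census.CoverClosure

noncomputable section

variable {G : Type*} [Group G] [Fintype G] [DecidableEq G] (c : G)

/-! ## §1 Representatives and swapped pairs -/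

omit [Fintype G] [DecidableEq G] in
/-- Two elements of a CM type lying in the same place are equal. [folklore] -/
theorem rep_unique' {T : Finset G} (hT : IsCMF c T) {x y z : G} (hx : x ∈ T) (hy : y ∈ T) (h1 : x = z ∨ x = c * z) (h2 : y = z ∨ y = c * z) :
    x = y := by
  rcases h1 with rfl | rfl <;> rcases h2 with h | h
  · exact h.symm
  · exact absurd (h ▸ hy) ((hT x).mp hx)
  · subst h; exact absurd hx ((hT y).mp hy)
  · exact h.symm

omit [Fintype G] in
/-- **A swapped pair is stable**: if `s' ∈ T₀` represents the place of `s·Q` (`s ∈ T₀`, `Q² = 1`), then for every `t ∈ T₀` with representative `t'` of the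
place of `t·Q`: `t ∈ {s, s'} ↔ t' ∈ {s, s'}`. [folklore] -/
theorem pair_stable (hc2 : c * c = 1) {T : Finset G} (hT : IsCMF c T) {Q : G} (hQQ : Q * Q = 1) {s s' : G} (hs : s ∈ T) (hs' : s' ∈ T)
    (hss' : s' = s * Q ∨ s' = c * (s * Q)) {t t' : G} (ht : t ∈ T) (ht' : t' ∈ T) (h : t' = t * Q ∨ t' = c * (t * Q)) :
    t ∈ ({s, s'} : Finset G) ↔ t' ∈ ({s, s'} : Finset G) := by
  have hback : t = t' * Q ∨ t = c * (t' * Q) := rep_rep c hc2 hQQ h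
  have hsback : s = s' * Q ∨ s = c * (s' * Q) := rep_rep c hc2 hQQ hss'
  rw [mem_insert, mem_singleton, mem_insert, mem_singleton]
  constructor
  · rintro (rfl | rfl)
    · exact Or.inr (rep_unique' c hT ht' hs' h hss')
    · exact Or.inl (rep_unique' c hT ht' hs h hsback)
  · rintro (rfl | rfl)
    · exact Or.inr (rep_unique' c hT ht hs' hback hss')
    · exact Or.inl (rep_unique' c hT ht hs hback hsback)

/-! ## §2 Swapped transversals and the difference of their relations -/

/-- **SWAPPED TRANSVERSAL.**  If `T ⊆ 𝓗` is a transversal of the place permutation on `𝓗` and `s ∈ T` with image `s'`, then `(T.erase s) ∪ {s'}` is again a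
transversal inside `𝓗`, of the same size, with `s' ∉ T`, `s' ∈ 𝓗`. [folklore] -/
theorem transversal_swap (hc2 : c * c = 1) (T₀ T₁ : CMF G c) {Q : G} (hQQ : Q * Q = 1)
    (hσH : ∀ t ∈ T₀.1, ∀ t' ∈ T₀.1, (t' = t * Q ∨ t' = c * (t * Q)) → (t ∈ T₀.1 \ T₁.1 ↔ t' ∈ T₀.1 \ T₁.1))
    (T : Finset G) (hTH : T ⊆ T₀.1 \ T₁.1)
    (hT : ∀ t ∈ T₀.1 \ T₁.1, ∀ t' ∈ T₀.1, (t' = t * Q ∨ t' = c * (t * Q)) → (t ∈ T ↔ t' ∉ T))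
    {s s' : G} (hs : s ∈ T) (hs'0 : s' ∈ T₀.1) (hss' : s' = s * Q ∨ s' = c * (s * Q)) :
    s' ∉ T ∧ s' ∈ T₀.1 \ T₁.1 ∧ insert s' (T.erase s) ⊆ T₀.1 \ T₁.1 ∧ (insert s' (T.erase s)).card = T.card ∧
      ∀ t ∈ T₀.1 \ T₁.1, ∀ t' ∈ T₀.1, (t' = t * Q ∨ t' = c * (t * Q)) → (t ∈ insert s' (T.erase s) ↔ t' ∉ insert s' (T.erase s)) := by
  have hsH : s ∈ T₀.1 \ T₁.1 := hTH hs
  have hs'T : s' ∉ T := (hT s hsH s' hs'0 hss').mp hs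
  have hs'H : s' ∈ T₀.1 \ T₁.1 := (hσH s (mem_sdiff.mp hsH).1 s' hs'0 hss').mp hsH
  have hne : s ≠ s' := fun h => hs'T (h ▸ hs)
  refine ⟨hs'T, hs'H, ?_, ?_, fun t ht t' ht' h => ?_⟩
  · intro x hx
    rcases mem_insert.mp hx with rfl | hx
    · exact hs'H
    · exact hTH (mem_of_mem_erase hx)
  · rw [card_insert_of_notMem (fun h => hs'T (mem_of_mem_erase h)), card_erase_of_mem hs]; exact Nat.sub_add_cancel (card_pos.mpr ⟨s, hs⟩)
  · have hstab := pair_stable c hc2 T₀.2 hQQ (mem_sdiff.mp hsH).1 hs'0 hss' (mem_sdiff.mp ht).1 ht' h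
    have key := hT t ht t' ht' h
    simp only [mem_insert, mem_erase]
    by_cases hts : t = s
    · have ht's : t' = s' := by
        have h1 := hstab.mp (by rw [mem_insert, mem_singleton]; exact Or.inl hts)
        rw [mem_insert, mem_singleton] at h1
        rcases h1 with h1 | h1
        · exfalso; rw [hts, h1] at key; exact iff_not_self key
        · exact h1
      rw [hts, ht's]
      simp [hne, hne.symm, hs'T]
    · by_cases hts' : t = s'
      · have ht's : t' = s := by
          have h1 := hstab.mp (by rw [mem_insert, mem_singleton]; exact Or.inr hts')
          rw [mem_insert, mem_singleton] at h1
          rcases h1 with h1 | h1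
          · exact h1
          · exfalso; rw [hts', h1] at key; exact iff_not_self key
        rw [hts', ht's]
        simp [hne, hs]
      · have ht'1 : t' ≠ s := fun e => by
          have h1 := hstab.mpr (by rw [mem_insert, mem_singleton]; exact Or.inl e)
          rw [mem_insert, mem_singleton] at h1
          rcases h1 with h1 | h1
          · exact hts h1
          · exact hts' h1
        have ht'2 : t' ≠ s' := fun e => by
          have h1 := hstab.mpr (by rw [mem_insert, mem_singleton]; exact Or.inr e)
          rw [mem_insert, mem_singleton] at h1
          rcases h1 with h1 | h1
          · exact hts h1
          · exact hts' h1
        simp only [hts', false_or, hts, ne_eq, not_false_eq_true, true_and, ht'2, ht'1]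
        exact key

section Frame

variable (hc2 : c * c = 1) (hcen : ∀ x : G, x * c = c * x) (T₀ T₁ : CMF G c)
variable (hbase : ∀ Q : G, rt c Q T₀ = T₀ ∨ rt c Q T₀ = rt c c T₀ ∨ rt c Q T₀ = T₁ ∨ rt c Q T₀ = rt c c T₁)
variable (m : ℕ) (hn : T₀.1.card = 4 * m) (hH : (T₀.1 \ T₁.1).card = 2 * m)
variable (Q : G) (hQ : rt c Q T₀ = T₁) (hQQ : Q * Q = 1)
variable (hσH : ∀ t ∈ T₀.1, ∀ t' ∈ T₀.1, (t' = t * Q ∨ t' = c * (t * Q)) → (t ∈ T₀.1 \ T₁.1 ↔ t' ∈ T₀.1 \ T₁.1))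
variable (L : Submodule ℤ (CMF G c →₀ ℤ)) (hLrt : ∀ (Q' : G) (y : CMF G c →₀ ℤ), y ∈ L → Finsupp.mapDomain (rt c Q') y ∈ L)
variable (hcover : ∀ Ψ : CMF G c, 2 ≤ bpot c T₀ Ψ → ∃ Q₂ s s' : G, bpot c T₀ Ψ = ddist (rt c Q₂ T₀) Ψ ∧
    s ∈ (rt c Q₂ T₀).1 \ Ψ.1 ∧ s' ∈ (rt c Q₂ T₀).1 \ Ψ.1 ∧ s ≠ s' ∧
    gface c hc2 Ψ s s' ∈ L ∧
    ((∃ Q₁ t t' : G, bpot c T₀ Ψ = ddist (rt c Q₁ T₀) Ψ ∧ t ∈ (rt c Q₁ T₀).1 \ Ψ.1 ∧ t' ∈ (rt c Q₁ T₀).1 \ Ψ.1 ∧ t ≠ t' ∧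
        (∀ Q' : G, ddist (rt c Q' T₀) (oflipCM c hc2 t Ψ) = bpot c T₀ (oflipCM c hc2 t Ψ) → rt c Q' T₀ = rt c Q₁ T₀) ∧
        (∀ Q' : G, ddist (rt c Q' T₀) (oflipCM c hc2 t' Ψ) = bpot c T₀ (oflipCM c hc2 t' Ψ) → rt c Q' T₀ = rt c Q₁ T₀) ∧
        (∀ Q' : G, ddist (rt c Q' T₀) (oflipCM c hc2 t (oflipCM c hc2 t' Ψ)) = bpot c T₀ (oflipCM c hc2 t (oflipCM c hc2 t' Ψ)) →
          rt c Q' T₀ = rt c Q₁ T₀)) →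
      (∀ Q' : G, ddist (rt c Q' T₀) (oflipCM c hc2 s Ψ) = bpot c T₀ (oflipCM c hc2 s Ψ) → rt c Q' T₀ = rt c Q₂ T₀) ∧
      (∀ Q' : G, ddist (rt c Q' T₀) (oflipCM c hc2 s' Ψ) = bpot c T₀ (oflipCM c hc2 s' Ψ) → rt c Q' T₀ = rt c Q₂ T₀) ∧
      (∀ Q' : G, ddist (rt c Q' T₀) (oflipCM c hc2 s (oflipCM c hc2 s' Ψ)) = bpot c T₀ (oflipCM c hc2 s (oflipCM c hc2 s' Ψ)) →
        rt c Q' T₀ = rt c Q₂ T₀)))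

include hc2 hcen hbase hn hH hQ hQQ hσH hLrt hcover in
/-- **`Y_s − Y_{σs} ∈ L`**: for a transversal `T ⊆ 𝓗` (`|T| = m ≥ 2`) containing `s`, with `s'` the image of `s`:
`(f_s + g_s) − (f_{s'} + g_{s'}) ∈ L` — the difference `R(T) − R(T.erase s ∪ {s'})` of two transversal relations. [folklore] -/
theorem Y_sub_Y_mem (hm : 2 ≤ m) (T : Finset G) (hTH : T ⊆ T₀.1 \ T₁.1) (hTm : T.card = m)
    (hT : ∀ t ∈ T₀.1 \ T₁.1, ∀ t' ∈ T₀.1, (t' = t * Q ∨ t' = c * (t * Q)) → (t ∈ T ↔ t' ∉ T))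
    {s s' : G} (hs : s ∈ T) (hs'0 : s' ∈ T₀.1) (hss' : s' = s * Q ∨ s' = c * (s * Q)) :
    (Finsupp.single (oflipCM c hc2 s T₀) (1 : ℤ) + Finsupp.single (oflipCM c hc2 s T₁) 1) -
      (Finsupp.single (oflipCM c hc2 s' T₀) (1 : ℤ) + Finsupp.single (oflipCM c hc2 s' T₁) 1) ∈ L := by
  obtain ⟨hs'T, hs'H, hsub, hcard, hT'⟩ := transversal_swap c hc2 T₀ T₁ hQQ hσH T hTH hT hs hs'0 hss'
  have hne : s ≠ s' := fun h => hs'T (h ▸ hs)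
  have hsH : s ∈ T₀.1 \ T₁.1 := hTH hs
  have h1 := rel_transversal_mem c hc2 hcen T₀ T₁ hbase m hn hH Q hQ hQQ hσH L hLrt hcover hm T hTH hTm hT
  have h2 := rel_transversal_mem c hc2 hcen T₀ T₁ hbase m hn hH Q hQ hQQ hσH L hLrt hcover hm _ hsub (hcard.trans hTm) hT'
  have hdiff := Submodule.sub_mem _ h1 h2
  -- the sums over the two transversals
  have hs'e : s' ∉ T.erase s := fun h => hs'T (mem_of_mem_erase h)
  have hset : (T₀.1 \ T₁.1) \ insert s' (T.erase s) = insert s (((T₀.1 \ T₁.1) \ T).erase s') := by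
    have h1 := mem_sdiff.mp hsH
    ext x
    simp only [mem_sdiff, mem_insert, mem_erase]
    by_cases hxs : x = s
    · subst hxs
      constructor
      · intro _; exact Or.inl rfl
      · intro _; exact ⟨h1, fun h => h.elim (fun e => hne e) (fun h' => h'.1 rfl)⟩
    · constructor
      · rintro ⟨hx, h⟩
        refine Or.inr ⟨fun e => h (Or.inl e), hx, fun hxT => h (Or.inr ⟨hxs, hxT⟩)⟩
      · rintro (h | ⟨hxs', hx, hxT⟩)
        · exact absurd h hxs
        · exact ⟨hx, fun h => h.elim (fun e => hxs' e) (fun h' => hxT h'.2)⟩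
  have hse : s ∉ ((T₀.1 \ T₁.1) \ T).erase s' := fun h => (mem_sdiff.mp (mem_of_mem_erase h)).2 hs
  have hs'D : s' ∈ (T₀.1 \ T₁.1) \ T := mem_sdiff.mpr ⟨hs'H, hs'T⟩
  rw [hset, sum_insert hs'e, sum_insert hse, ← add_sum_erase T _ hs, ← add_sum_erase _ _ hs'D] at hdiff
  have e : (Finsupp.single (oflipCM c hc2 s T₀) (1 : ℤ) + Finsupp.single (oflipCM c hc2 s T₁) 1) -
      (Finsupp.single (oflipCM c hc2 s' T₀) (1 : ℤ) + Finsupp.single (oflipCM c hc2 s' T₁) 1) =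
      (Finsupp.single (oflipCM c hc2 s T₀) (1 : ℤ) + ∑ x ∈ T.erase s, Finsupp.single (oflipCM c hc2 x T₀) (1 : ℤ) -
        (Finsupp.single (oflipCM c hc2 s' T₁) (1 : ℤ) + ∑ x ∈ ((T₀.1 \ T₁.1) \ T).erase s', Finsupp.single (oflipCM c hc2 x T₁) (1 : ℤ)) -
        ((m : ℤ) - 1) • (Finsupp.single T₀ (1 : ℤ) - Finsupp.single T₁ 1)) -
      (Finsupp.single (oflipCM c hc2 s' T₀) (1 : ℤ) + ∑ x ∈ T.erase s, Finsupp.single (oflipCM c hc2 x T₀) (1 : ℤ) -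
        (Finsupp.single (oflipCM c hc2 s T₁) (1 : ℤ) + ∑ x ∈ ((T₀.1 \ T₁.1) \ T).erase s', Finsupp.single (oflipCM c hc2 x T₁) (1 : ℤ)) -
        ((m : ℤ) - 1) • (Finsupp.single T₀ (1 : ℤ) - Finsupp.single T₁ 1)) := by abel
  rw [e]; exact hdiff

include hcen hbase hn hH hQ hQQ hσH hLrt hcover in
/-- **`Y'_a + Y'_{σa} ∈ L`** (`m ≥ 3`, some transversal `T ⊆ 𝓗` of size `m`): for `a ∈ T₀ ∩ T₁` with swap image `a' ≠ a`,
`((f_a − e₀) − (g_a − e₁)) + ((f_{a'} − e₀) − (g_{a'} − e₁)) ∈ L`. [folklore] -/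
theorem Y'_add_Y'_mem (hm : 3 ≤ m) (T : Finset G) (hTH : T ⊆ T₀.1 \ T₁.1) (hTm : T.card = m)
    (hT : ∀ t ∈ T₀.1 \ T₁.1, ∀ t' ∈ T₀.1, (t' = t * Q ∨ t' = c * (t * Q)) → (t ∈ T ↔ t' ∉ T))
    {a a' : G} (ha : a ∈ T₀.1) (ha1 : a ∈ T₁.1) (ha' : a' ∈ T₀.1) (haa' : a' = a * Q ∨ a' = c * (a * Q)) (hne : a ≠ a') :
    ((Finsupp.single (oflipCM c hc2 a T₀) (1 : ℤ) - Finsupp.single T₀ 1) - (Finsupp.single (oflipCM c hc2 a T₁) (1 : ℤ) - Finsupp.single T₁ 1)) +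
      ((Finsupp.single (oflipCM c hc2 a' T₀) (1 : ℤ) - Finsupp.single T₀ 1) - (Finsupp.single (oflipCM c hc2 a' T₁) (1 : ℤ) - Finsupp.single T₁ 1))
      ∈ L := by
  have h1 := rel_transversal_mem c hc2 hcen T₀ T₁ hbase m hn hH Q hQ hQQ hσH L hLrt hcover (by omega) T hTH hTm hT
  have h2 := rel_transversal_pair_mem c hc2 hcen T₀ T₁ hbase m hn hH Q hQ hQQ hσH L hLrt hcover hm T hTH hTm hT ha ha1 ha' haa' hne
  have h := Submodule.sub_mem _ h2 h1
  rwa [add_assoc, add_sub_cancel_left] at h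

/-! ## §3 The companion frame `(T₀; T̄₁, c·Q)` -/

include hc2 hbase in
/-- The base block seen with `T̄₁` as the second base type. [folklore] -/
theorem companion_base : ∀ Q' : G, rt c Q' T₀ = T₀ ∨ rt c Q' T₀ = rt c c T₀ ∨ rt c Q' T₀ = rt c c T₁ ∨ rt c Q' T₀ = rt c c (rt c c T₁) := by
  intro Q'
  have e : rt c c (rt c c T₁) = T₁ := by rw [← rt_mul, hc2, rt_one]
  rw [e]
  rcases hbase Q' with h | h | h | h
  · exact Or.inl h
  · exact Or.inr (Or.inl h)
  · exact Or.inr (Or.inr (Or.inr h))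
  · exact Or.inr (Or.inr (Or.inl h))

include hcen hn hH in
/-- `|T₀ ∖ T̄₁| = |T₀ ∩ T₁| = 2m`. [folklore] -/
theorem companion_card : (T₀.1 \ (rt c c T₁).1).card = 2 * m := by
  rw [dev_compl c hcen T₀ T₁, card_sdiff_of_subset sdiff_subset, hn, hH]; omega

include hQ in
/-- `T₀·(cQ)⁻¹ = T̄₁`. [folklore] -/
theorem companion_rt : rt c (c * Q) T₀ = rt c c T₁ := by rw [rt_mul, hQ]

include hc2 hcen hQQ in
omit [Fintype G] [DecidableEq G] in
/-- `(cQ)² = 1`. [folklore] -/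
theorem companion_sq : c * Q * (c * Q) = 1 := by
  rw [mul_assoc, ← mul_assoc Q c Q, hcen Q, mul_assoc, hQQ, mul_one, hc2]

include hc2 hcen in
omit [Fintype G] [DecidableEq G] in
/-- The place alternatives for `c·Q` are those for `Q`. [folklore] -/
theorem or_companion_iff (t t' : G) : (t' = t * (c * Q) ∨ t' = c * (t * (c * Q))) ↔ (t' = t * Q ∨ t' = c * (t * Q)) := by
  have e1 : t * (c * Q) = c * (t * Q) := by rw [← mul_assoc, hcen t, mul_assoc]
  rw [e1, show c * (c * (t * Q)) = t * Q by rw [← mul_assoc, hc2, one_mul]]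
  exact Or.comm

include hc2 hcen hσH in
/-- The place permutation of `c·Q` preserves `T₀ ∖ T̄₁`. [folklore] -/
theorem companion_swap : ∀ t ∈ T₀.1, ∀ t' ∈ T₀.1, (t' = t * (c * Q) ∨ t' = c * (t * (c * Q))) →
    (t ∈ T₀.1 \ (rt c c T₁).1 ↔ t' ∈ T₀.1 \ (rt c c T₁).1) := by
  intro t ht t' ht' h
  rw [or_companion_iff c hc2 hcen Q] at h
  have key := hσH t ht t' ht' h
  rw [dev_compl c hcen T₀ T₁, mem_sdiff, mem_sdiff]
  rw [mem_sdiff, mem_sdiff] at key ⊢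
  tauto

include hcen hbase hn hH hQ hQQ hσH hLrt hcover in
/-- **`Rᶜ(T') ∈ L`** (`m ≥ 2`, all pairs in `L`): for every transversal `T' ⊆ T₀ ∩ T₁` of the place permutation with `|T'| = m`,
`Σ_{s∈T'} f_s + Σ_{u ∈ (T₀∩T₁)∖T'} g_u − (m−1)·(e₀ + e₁) ∈ L` — the transversal relation of the companion frame, modulo pairs. [folklore] -/
theorem relc_mem (hP : ∀ Ψ : CMF G c, pair c Ψ ∈ L) (hm : 2 ≤ m) (T' : Finset G) (hTH : T' ⊆ T₀.1 ∩ T₁.1) (hTm : T'.card = m)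
    (hT : ∀ t ∈ T₀.1 ∩ T₁.1, ∀ t' ∈ T₀.1, (t' = t * Q ∨ t' = c * (t * Q)) → (t ∈ T' ↔ t' ∉ T')) :
    ∑ s ∈ T', Finsupp.single (oflipCM c hc2 s T₀) (1 : ℤ) + ∑ u ∈ (T₀.1 ∩ T₁.1) \ T', Finsupp.single (oflipCM c hc2 u T₁) (1 : ℤ) -
      ((m : ℤ) - 1) • (Finsupp.single T₀ (1 : ℤ) + Finsupp.single T₁ 1) ∈ L := by
  have hHc : T₀.1 \ (rt c c T₁).1 = T₀.1 ∩ T₁.1 := by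
    rw [dev_compl c hcen T₀ T₁]; ext t; simp only [mem_sdiff, mem_inter, not_and, not_not]; tauto
  have hT2 : ∀ t ∈ T₀.1 \ (rt c c T₁).1, ∀ t' ∈ T₀.1, (t' = t * (c * Q) ∨ t' = c * (t * (c * Q))) → (t ∈ T' ↔ t' ∉ T') := by
    intro t ht t' ht' h
    rw [or_companion_iff c hc2 hcen Q] at h
    rw [hHc] at ht
    exact hT t ht t' ht' h
  have h := rel_transversal_mem c hc2 hcen T₀ (rt c c T₁) (companion_base c hc2 T₀ T₁ hbase) m hn (companion_card c hcen T₀ T₁ m hn hH)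
    (c * Q) (companion_rt c T₀ T₁ Q hQ) (companion_sq c hc2 hcen Q hQQ) (companion_swap c hc2 hcen T₀ T₁ Q hσH) L hLrt
    hcover hm T' (by rw [hHc]; exact hTH) hTm hT2
  rw [hHc] at h
  have hsr : ∀ X : CMF G c, Finsupp.single (rt c c X) (1 : ℤ) = pair c X - Finsupp.single X 1 := fun X => by
    rw [pair, add_sub_cancel_left]
  simp only [oflipCM_rt_self c hc2 hcen, hsr] at h
  -- `h` : Σ f − Σ (pair − g) − (m−1)(e₀ − (pair T₁ − e₁)) ∈ L ; add the pairs back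
  have hp1 : ∑ u ∈ (T₀.1 ∩ T₁.1) \ T', pair c (oflipCM c hc2 u T₁) ∈ L := Submodule.sum_mem _ fun u _ => hP _
  have hp2 : ((m : ℤ) - 1) • pair c T₁ ∈ L := Submodule.smul_mem _ _ (hP T₁)
  have hsum : ∑ u ∈ (T₀.1 ∩ T₁.1) \ T', (pair c (oflipCM c hc2 u T₁) - Finsupp.single (oflipCM c hc2 u T₁) (1 : ℤ)) =
      ∑ u ∈ (T₀.1 ∩ T₁.1) \ T', pair c (oflipCM c hc2 u T₁) - ∑ u ∈ (T₀.1 ∩ T₁.1) \ T', Finsupp.single (oflipCM c hc2 u T₁) (1 : ℤ) :=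
    sum_sub_distrib _ _
  rw [hsum] at h
  have e : ∑ s ∈ T', Finsupp.single (oflipCM c hc2 s T₀) (1 : ℤ) + ∑ u ∈ (T₀.1 ∩ T₁.1) \ T', Finsupp.single (oflipCM c hc2 u T₁) (1 : ℤ) -
      ((m : ℤ) - 1) • (Finsupp.single T₀ (1 : ℤ) + Finsupp.single T₁ 1) =
      (∑ s ∈ T', Finsupp.single (oflipCM c hc2 s T₀) (1 : ℤ) -
        (∑ u ∈ (T₀.1 ∩ T₁.1) \ T', pair c (oflipCM c hc2 u T₁) - ∑ u ∈ (T₀.1 ∩ T₁.1) \ T', Finsupp.single (oflipCM c hc2 u T₁) (1 : ℤ)) -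
        ((m : ℤ) - 1) • (Finsupp.single T₀ (1 : ℤ) - (pair c T₁ - Finsupp.single T₁ 1))) +
      ∑ u ∈ (T₀.1 ∩ T₁.1) \ T', pair c (oflipCM c hc2 u T₁) - ((m : ℤ) - 1) • pair c T₁ := by module
  rw [e]
  exact Submodule.sub_mem _ (Submodule.add_mem _ h hp1) hp2

include hcen hbase hn hH hQ hQQ hσH hLrt hcover in
/-- **`Y_s + Y_{σs} ∈ L`** (`m ≥ 3`, pairs in `L`, a transversal `T' ⊆ T₀ ∩ T₁` of size `m`): for `s ∈ 𝓗` with swap image `s' ≠ s`,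
`((f_s − e₀) + (g_s − e₁)) + ((f_{s'} − e₀) + (g_{s'} − e₁)) ∈ L` — the pair relation of the companion frame, modulo pairs. [folklore] -/
theorem Y_add_Y_mem (hP : ∀ Ψ : CMF G c, pair c Ψ ∈ L) (hm : 3 ≤ m) (T' : Finset G) (hTH : T' ⊆ T₀.1 ∩ T₁.1) (hTm : T'.card = m)
    (hT : ∀ t ∈ T₀.1 ∩ T₁.1, ∀ t' ∈ T₀.1, (t' = t * Q ∨ t' = c * (t * Q)) → (t ∈ T' ↔ t' ∉ T'))
    {s s' : G} (hs : s ∈ T₀.1 \ T₁.1) (hs' : s' ∈ T₀.1) (hss' : s' = s * Q ∨ s' = c * (s * Q)) (hne : s ≠ s') :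
    ((Finsupp.single (oflipCM c hc2 s T₀) (1 : ℤ) - Finsupp.single T₀ 1) + (Finsupp.single (oflipCM c hc2 s T₁) (1 : ℤ) - Finsupp.single T₁ 1)) +
      ((Finsupp.single (oflipCM c hc2 s' T₀) (1 : ℤ) - Finsupp.single T₀ 1) + (Finsupp.single (oflipCM c hc2 s' T₁) (1 : ℤ) - Finsupp.single T₁ 1))
      ∈ L := by
  have hHc : T₀.1 \ (rt c c T₁).1 = T₀.1 ∩ T₁.1 := by
    rw [dev_compl c hcen T₀ T₁]; ext t; simp only [mem_sdiff, mem_inter, not_and, not_not]; tauto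
  have hT2 : ∀ t ∈ T₀.1 \ (rt c c T₁).1, ∀ t' ∈ T₀.1, (t' = t * (c * Q) ∨ t' = c * (t * (c * Q))) → (t ∈ T' ↔ t' ∉ T') := by
    intro t ht t' ht' h
    rw [or_companion_iff c hc2 hcen Q] at h
    rw [hHc] at ht
    exact hT t ht t' ht' h
  have hs1 : s ∈ (rt c c T₁).1 := by rw [rt_self_val c hcen]; exact mem_sdiff.mpr ⟨mem_univ _, (mem_sdiff.mp hs).2⟩
  have h := Y'_add_Y'_mem c hc2 hcen T₀ (rt c c T₁) (companion_base c hc2 T₀ T₁ hbase) m hn (companion_card c hcen T₀ T₁ m hn hH)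
    (c * Q) (companion_rt c T₀ T₁ Q hQ) (companion_sq c hc2 hcen Q hQQ) (companion_swap c hc2 hcen T₀ T₁ Q hσH) L hLrt
    hcover hm T' (by rw [hHc]; exact hTH) hTm hT2 (mem_sdiff.mp hs).1 hs1 hs'
    ((or_companion_iff c hc2 hcen Q s s').mpr hss') hne
  have hsr : ∀ X : CMF G c, Finsupp.single (rt c c X) (1 : ℤ) = pair c X - Finsupp.single X 1 := fun X => by
    rw [pair, add_sub_cancel_left]
  simp only [oflipCM_rt_self c hc2 hcen, hsr] at h
  have hp : pair c (oflipCM c hc2 s T₁) + pair c (oflipCM c hc2 s' T₁) - (2 : ℤ) • pair c T₁ ∈ L :=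
    Submodule.sub_mem _ (Submodule.add_mem _ (hP _) (hP _)) (Submodule.smul_mem _ _ (hP _))
  have e : ((Finsupp.single (oflipCM c hc2 s T₀) (1 : ℤ) - Finsupp.single T₀ 1) + (Finsupp.single (oflipCM c hc2 s T₁) (1 : ℤ) - Finsupp.single T₁ 1)) +
      ((Finsupp.single (oflipCM c hc2 s' T₀) (1 : ℤ) - Finsupp.single T₀ 1) + (Finsupp.single (oflipCM c hc2 s' T₁) (1 : ℤ) - Finsupp.single T₁ 1)) =
      (((Finsupp.single (oflipCM c hc2 s T₀) (1 : ℤ) - Finsupp.single T₀ 1) -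
          ((pair c (oflipCM c hc2 s T₁) - Finsupp.single (oflipCM c hc2 s T₁) 1) - (pair c T₁ - Finsupp.single T₁ 1))) +
        ((Finsupp.single (oflipCM c hc2 s' T₀) (1 : ℤ) - Finsupp.single T₀ 1) -
          ((pair c (oflipCM c hc2 s' T₁) - Finsupp.single (oflipCM c hc2 s' T₁) 1) - (pair c T₁ - Finsupp.single T₁ 1)))) +
      (pair c (oflipCM c hc2 s T₁) + pair c (oflipCM c hc2 s' T₁) - (2 : ℤ) • pair c T₁) := by module
  rw [e]
  exact Submodule.add_mem _ h hp

include hc2 hcen hbase hn hH hQ hQQ hσH hLrt hcover in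
/-- **`Y'_a − Y'_{σa} ∈ L`** (`m ≥ 2`, pairs in `L`): for a transversal `T' ⊆ T₀ ∩ T₁` of size `m` containing `a`, with `a'` the image of `a`:
`(f_a − g_a) − (f_{a'} − g_{a'}) ∈ L` — a difference of two companion transversal relations, modulo pairs. [folklore] -/
theorem Y'_sub_Y'_mem (hP : ∀ Ψ : CMF G c, pair c Ψ ∈ L) (hm : 2 ≤ m) (T' : Finset G) (hTH : T' ⊆ T₀.1 ∩ T₁.1) (hTm : T'.card = m)
    (hT : ∀ t ∈ T₀.1 ∩ T₁.1, ∀ t' ∈ T₀.1, (t' = t * Q ∨ t' = c * (t * Q)) → (t ∈ T' ↔ t' ∉ T'))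
    {a a' : G} (ha : a ∈ T') (ha'0 : a' ∈ T₀.1) (haa' : a' = a * Q ∨ a' = c * (a * Q)) :
    (Finsupp.single (oflipCM c hc2 a T₀) (1 : ℤ) - Finsupp.single (oflipCM c hc2 a T₁) 1) -
      (Finsupp.single (oflipCM c hc2 a' T₀) (1 : ℤ) - Finsupp.single (oflipCM c hc2 a' T₁) 1) ∈ L := by
  have hHc : T₀.1 \ (rt c c T₁).1 = T₀.1 ∩ T₁.1 := by
    rw [dev_compl c hcen T₀ T₁]; ext t; simp only [mem_sdiff, mem_inter, not_and, not_not]; tauto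
  have hT2 : ∀ t ∈ T₀.1 \ (rt c c T₁).1, ∀ t' ∈ T₀.1, (t' = t * (c * Q) ∨ t' = c * (t * (c * Q))) → (t ∈ T' ↔ t' ∉ T') := by
    intro t ht t' ht' h
    rw [or_companion_iff c hc2 hcen Q] at h
    rw [hHc] at ht
    exact hT t ht t' ht' h
  have h := Y_sub_Y_mem c hc2 hcen T₀ (rt c c T₁) (companion_base c hc2 T₀ T₁ hbase) m hn (companion_card c hcen T₀ T₁ m hn hH)
    (c * Q) (companion_rt c T₀ T₁ Q hQ) (companion_sq c hc2 hcen Q hQQ) (companion_swap c hc2 hcen T₀ T₁ Q hσH) L hLrt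
    hcover hm T' (by rw [hHc]; exact hTH) hTm hT2 ha ha'0 ((or_companion_iff c hc2 hcen Q a a').mpr haa')
  have hsr : ∀ X : CMF G c, Finsupp.single (rt c c X) (1 : ℤ) = pair c X - Finsupp.single X 1 := fun X => by
    rw [pair, add_sub_cancel_left]
  simp only [oflipCM_rt_self c hc2 hcen, hsr] at h
  have hp : pair c (oflipCM c hc2 a' T₁) - pair c (oflipCM c hc2 a T₁) ∈ L := Submodule.sub_mem _ (hP _) (hP _)
  have e : (Finsupp.single (oflipCM c hc2 a T₀) (1 : ℤ) - Finsupp.single (oflipCM c hc2 a T₁) 1) -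
      (Finsupp.single (oflipCM c hc2 a' T₀) (1 : ℤ) - Finsupp.single (oflipCM c hc2 a' T₁) 1) =
      ((Finsupp.single (oflipCM c hc2 a T₀) (1 : ℤ) + (pair c (oflipCM c hc2 a T₁) - Finsupp.single (oflipCM c hc2 a T₁) 1)) -
        (Finsupp.single (oflipCM c hc2 a' T₀) (1 : ℤ) + (pair c (oflipCM c hc2 a' T₁) - Finsupp.single (oflipCM c hc2 a' T₁) 1))) +
      (pair c (oflipCM c hc2 a' T₁) - pair c (oflipCM c hc2 a T₁)) := by module
  rw [e]
  exact Submodule.add_mem _ h hp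

end Frame

end

end Summit.HodgeConjecture.CorCM.Census.CentralSquares
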